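import Summits.BirchSwinnertonDyer.BirchSwinnertonDyer.Theorems.SmallImageMuTransferMuTransferX9SelmerDualLocalEmbedKernel
import Summits.BirchSwinnertonDyer.BirchSwinnertonDyer.Theorems.SmallImageMuTransferMuTransferX9SelmerDualTotallyRamified
import Literature.NumberTheory.EllipticCurves.WeilPairingTateDual
import Literature.NumberTheory.EllipticCurves.IwasawaTwistModPDual
import HarnessLib

/-!
# K6 crux `MuTransferX9` (stmt-BirchSwinnertonDyer-19276), stub `stub_selmerDualOdd` (skeleton v6),
# local lemma (L-p): (Lp-3) INSTANTIATED — the hypothesis `h3` of k6-c2's `SelmerDual.localP_of`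
# for `𝒯_•(E, κ^{±1}) = W.modPTwist p κ^{±1} •` at the place `v ∣ p`, with a uniform exponent

Cell `bsd-smallim`, seat `bsd-smallim-k6-lur-b` (gen 0).  HONEST FRAMING: theorems only (no definition, no
named fact, no `sorry`); nothing is asserted about any particular curve and nothing is booked.  Helper
toward the registered stub `stub_selmerDualOdd` of skeleton v6 (sha16 a90a661b046bb403) of crux 19276:
the plug `h3 : ∃ e, ∀ {J L} (hJL : J ≤ L) (c : H¹(ℚ, 𝒯_J(E, κ⁻¹))), loc_v (H¹(T^{L−J}-embed) c) = 0 →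
loc_v (T^[e] c) = 0` of k6-c2's `SelmerDual.localP_of` (p465054, STATUS 2026-08-26 20:40Z) VERBATIM, from
(Lp-3) `localization_shiftH1_iterate_eq_zero_of_localization_map_shiftEmbed_eq_zero` (p464777) at
`ρ := W.torsionGaloisModule p`, `κ := κ.invTwist` (its layers are `κ`'s, `ZpExtension.layerSubgroup_invTwist`),
with the depth element at `v ∣ p` supplied by (Lp-2) `exists_apply_absGaloisRestrict_ne_one` (p463558,
`κ` cyclotomic is non-trivial on `Γ_{ℚ_p}`) + k6-g4's `exists_trivial_depth_of_apply_ne_one` (an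
`E[p]`-trivial, `μ_p`-trivial power of depth `m`), and the crude bound `#E[p] ≤ p^{#E[p]}`; exponent
`e = #E[p] · p^m`.  Both twists `κ` and `κ⁻¹` (`exists_uniform_localization_shiftH1_iterate_eq_zero_of_map_shiftEmbed`,
`…_invTwist`); closes nothing.

PARTITION (D-0054): X9 (A4) × p ∈ {5,7} (+ X10b∧¬Surj at 3) — helper toward `stub_selmerDualOdd`; closes none.

References: B. Mazur, K. Rubin, Mem. AMS 799 (2004) §5.3, Lemma 5.3.1 [MazurRubin2004]; J.-P. Serre,
*Galois Cohomology* (1997) I §2.2 [SerreGaloisCohomology1997]; L. Washington, *Introduction to Cyclotomic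
Fields*, Prop. 13.2–13.3 [Washington1997]; HOME/koly/MU-TRANSFER-PROOF.md (F6), §5 STEP 1.
-/

set_option linter.dupNamespace false
set_option autoImplicit false

noncomputable section

open scoped NumberField
open Field IsDedekindDomain NumberField
open WeierstrassCurve (geomTorsion)
open Literature.NumberTheory.GaloisRepresentations
open Literature.NumberTheory.EllipticCurves
open Summit.BirchSwinnertonDyer.BirchSwinnertonDyer.Rank1Residual.LocalSplitPrime
  (exists_trivial_depth_of_apply_ne_one)

namespace Summit.BirchSwinnertonDyer.BirchSwinnertonDyer.Rank1Residual.SelmerDual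

variable (W : WeierstrassCurve ℚ) [W.IsElliptic] {p : ℕ} [Fact p.Prime] (κ : ZpExtension ℚ p)

/-- **A depth element at `p` acting trivially on `E[p]`** (for the cyclotomic `κ`): some `g ∈ Γ_{ℚ_p}` with
`ρ̄_{E,p}(res g) = 1`, `g` fixing `μ_p`, and `res g ∈ Γ_m ∖ Γ_{m+1}` for some `m` — (Lp-2)'s
`exists_apply_absGaloisRestrict_ne_one` fed into k6-g4's `exists_trivial_depth_of_apply_ne_one`.
[cite: Washington1997, Prop. 13.2–13.3] -/
theorem exists_trivial_depth_at_p (hκ : κ.IsCyclotomic) (v : HeightOneSpectrum (𝓞 ℚ))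
    (hv : ((p : ℕ) : 𝓞 ℚ) ∈ v.asIdeal) :
    ∃ (g : absoluteGaloisGroup (v.adicCompletion ℚ)) (m : ℕ),
      W.torsionGaloisModule (p : ℤ) (absGaloisRestrict ℚ (v.adicCompletion ℚ) g) = 1 ∧
      (∀ ζ : (AlgebraicClosure (v.adicCompletion ℚ))ˣ, ζ ^ p = 1 → g • ζ = ζ) ∧
      absGaloisRestrict ℚ (v.adicCompletion ℚ) g ∈ κ.layerSubgroup m ∧
      absGaloisRestrict ℚ (v.adicCompletion ℚ) g ∉ κ.layerSubgroup (m + 1) := by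
  haveI : NeZero p := ⟨(Fact.out : p.Prime).ne_zero⟩
  haveI : Finite (geomTorsion W (p : ℤ)) := finite_geomTorsion_of_neZero W p
  obtain ⟨τ, hτ⟩ := exists_apply_absGaloisRestrict_ne_one κ hκ v hv
  exact exists_trivial_depth_of_apply_ne_one (W.torsionGaloisModule (p : ℤ)) κ v τ hτ

/-- **`h3` of k6-c2's `localP_of`, for the twist `𝒯_•(E, κ)`**: at the place `v ∣ p`, ONE exponent `e`
such that for all levels `J ≤ L` and every global `c ∈ H¹(ℚ, 𝒯_J(E, κ))`,
`loc_v (H¹(T^{L−J}-embedding) c) = 0 ⟹ loc_v (T^[e] c) = 0` ((Lp-3) at a depth element at `p`;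
`e = #E[p] · p^m`). [cite: MazurRubin2004, Lemma 5.3.1] [cite: SerreGaloisCohomology1997, I §2.2] -/
theorem exists_uniform_localization_shiftH1_iterate_eq_zero_of_map_shiftEmbed (hκ : κ.IsCyclotomic)
    (v : HeightOneSpectrum (𝓞 ℚ)) (hv : ((p : ℕ) : 𝓞 ℚ) ∈ v.asIdeal) :
    ∃ e : ℕ, ∀ {J L : ℕ} (hJL : J ≤ L) (c : galoisCohomology (W.modPTwist p κ J) 1),
      galoisCohomology.localization (W.modPTwist p κ L) (Sum.inr v) 1
          (galoisCohomology.map (κ.twistModPShiftEmbed (W.torsionGaloisModule (p : ℤ))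
            (fun P => AddSubgroup.torsionBy.nsmul P) L hJL) 1 c) = 0 →
        galoisCohomology.localization (W.modPTwist p κ J) (Sum.inr v) 1
          ((κ.shiftH1 (W.torsionGaloisModule (p : ℤ)) (fun P => AddSubgroup.torsionBy.nsmul P) J)^[e] c)
            = 0 := by
  haveI : NeZero p := ⟨(Fact.out : p.Prime).ne_zero⟩
  haveI : Finite (geomTorsion W (p : ℤ)) := finite_geomTorsion_of_neZero W p
  obtain ⟨g, m, hg, -, hgm, hgm'⟩ := exists_trivial_depth_at_p W κ hκ v hv
  have hd : Nat.card (geomTorsion W (p : ℤ)) ≤ p ^ Nat.card (geomTorsion W (p : ℤ)) :=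
    (Nat.lt_pow_self (Fact.out : p.Prime).one_lt).le
  refine ⟨Nat.card (geomTorsion W (p : ℤ)) * p ^ m, fun hJL c hc => ?_⟩
  exact localization_shiftH1_iterate_eq_zero_of_localization_map_shiftEmbed_eq_zero
    (W.torsionGaloisModule (p : ℤ)) (fun P => AddSubgroup.torsionBy.nsmul P) κ v hg hgm hgm' hd hJL c hc

/-- **`h3` of k6-c2's `localP_of` VERBATIM — the DUAL twist `𝒯_•(E, κ⁻¹) = W.modPTwist p κ.invTwist •`**:
at the place `v ∣ p`, ONE exponent `e` such that for all `J ≤ L` and every global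
`c ∈ H¹(ℚ, 𝒯_J(E, κ⁻¹))`, `loc_v (H¹(T^{L−J}-embedding) c) = 0 ⟹ loc_v (T^[e] c) = 0` ((Lp-3) at
`κ := κ.invTwist`, whose layers are `κ`'s; `e = #E[p] · p^m`).
[cite: MazurRubin2004, Lemma 5.3.1] [cite: SerreGaloisCohomology1997, I §2.2] -/
theorem exists_uniform_localization_shiftH1_iterate_eq_zero_of_map_shiftEmbed_invTwist
    (hκ : κ.IsCyclotomic) (v : HeightOneSpectrum (𝓞 ℚ)) (hv : ((p : ℕ) : 𝓞 ℚ) ∈ v.asIdeal) :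
    ∃ e : ℕ, ∀ {J L : ℕ} (hJL : J ≤ L) (c : galoisCohomology (W.modPTwist p κ.invTwist J) 1),
      galoisCohomology.localization (W.modPTwist p κ.invTwist L) (Sum.inr v) 1
          (galoisCohomology.map (κ.invTwist.twistModPShiftEmbed (W.torsionGaloisModule (p : ℤ))
            (fun P => AddSubgroup.torsionBy.nsmul P) L hJL) 1 c) = 0 →
        galoisCohomology.localization (W.modPTwist p κ.invTwist J) (Sum.inr v) 1
          ((κ.invTwist.shiftH1 (W.torsionGaloisModule (p : ℤ)) (fun P => AddSubgroup.torsionBy.nsmul P) J)^[e]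
            c) = 0 := by
  haveI : NeZero p := ⟨(Fact.out : p.Prime).ne_zero⟩
  haveI : Finite (geomTorsion W (p : ℤ)) := finite_geomTorsion_of_neZero W p
  obtain ⟨g, m, hg, -, hgm, hgm'⟩ := exists_trivial_depth_at_p W κ hκ v hv
  have hgm₁ : absGaloisRestrict ℚ (v.adicCompletion ℚ) g ∈ κ.invTwist.layerSubgroup m := by
    rw [ZpExtension.layerSubgroup_invTwist]; exact hgm
  have hgm₁' : absGaloisRestrict ℚ (v.adicCompletion ℚ) g ∉ κ.invTwist.layerSubgroup (m + 1) := by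
    rw [ZpExtension.layerSubgroup_invTwist]; exact hgm'
  have hd : Nat.card (geomTorsion W (p : ℤ)) ≤ p ^ Nat.card (geomTorsion W (p : ℤ)) :=
    (Nat.lt_pow_self (Fact.out : p.Prime).one_lt).le
  refine ⟨Nat.card (geomTorsion W (p : ℤ)) * p ^ m, fun hJL c hc => ?_⟩
  exact localization_shiftH1_iterate_eq_zero_of_localization_map_shiftEmbed_eq_zero
    (W.torsionGaloisModule (p : ℤ)) (fun P => AddSubgroup.torsionBy.nsmul P) κ.invTwist v hg hgm₁ hgm₁' hd
    hJL c hc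

end Summit.BirchSwinnertonDyer.BirchSwinnertonDyer.Rank1Residual.SelmerDual

end
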